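import Summits.ABC.StewartYu.ArchG3LinesAtoms
import Summits.ABC.StewartYu.ArchG3RecLinesClosed
import Summits.ABC.StewartYu.ArchG3StartLetters
import Summits.ABC.StewartYu.ArchG3PackClosedV
import HarnessLib

/-!
# Cell abc-stewartyu, rung A1.L (crux r2 `ArchCoreRat`, stmt-ABC-20502), WP-L.A: the θ-SIDE ATOMS of the letter lines (part (A), sequel) —
# the directional atoms `GammaC`/`YC`, the Siegel count and height, the radicand heights, against the closed forms of `ArchG3RecLinesClosed`

`Summits/ABC/StewartYu/ArchG3LinesAtomsB.lean` — cell `abc-stewartyu` (HOME `run/shared/lean/pub/abc-stewartyu/`; seat p5 g9).  Theorems on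
`ArchG3Setup`/`SatData`; no definition, no named fact.  Under the shape letters of `ArchG3Line.StartDataS` and the datum's weight lines
(`|log α°ⱼ| ≤ Aⱼ = P.A j`, `|bⱼ|·Aⱼ ≤ B·A_{j₀}`, `P.W = log(eB)`, `P.N = F.N`):

* `jl_eq`, `LνR_eq_LνRR`, `Lb_le_LbR`, `Lb_last_le` — the schedules against the record majorants of `ArchG3RecLinesClosed`;
* **`gammaC_sum_le_yR`** — `Σₖ AθR k · GammaC (Lb lev) k ≤ yR lev` (the jets scalar of the (J) lines);
* **`YC_le_YR`** — `YC 1 0 (Lb lev) ≤ YR lev` (the Δ-weight ceiling of all lines);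
* `card_le_exp_cUR`, **`ceil_le_exp_cPR`** (with lp-1's `log_AmaxR_le`), `log_heightProd_le_cHR`, `colU_sum_le` — the global ceilings;
* `yR_div_CR_le`, `log_DΔC_mono`, `two_mul_le_exp_cbR` — bookkeeping for the assembly (`ArchG3LinesAssembly`).

WHAT THIS IS NOT: no inequality of the record (seat p1, `ArchG3Rec.linesClosed_holds`); no crux moves.

## References
* Yu. V. Nesterenko, LNM 1819 (2003) — §3.5 (3.25), (3.36)–(3.37), Lemma 3.11, Prop. 3.9; §4.2 (4.22); §4.3 (4.45). [Nesterenko2003]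
-/

noncomputable section

open Finset Matrix
open scoped Nat Matrix
open Literature.NumberTheory.Transcendental.CW77 (heightProd)
open Summit.ABC.StewartYu.ArchSupply (WC)

namespace Summit.ABC.StewartYu

namespace ArchG3Setup

variable {S : ArchG3Setup}

/-! ### The schedules against the record majorants -/

/-- the last index: `j₀ = P.jl` when every index is `≤ j₀`. [folklore] -/
theorem jl_eq (P : ArchG3Rec S.n) (hlast : ∀ j : Fin S.n, j ≤ S.j₀) : P.jl = S.j₀ := by
  have h := hlast ⟨S.n - 1, by have := P.hn; omega⟩
  apply Fin.ext
  show S.n - 1 = (S.j₀ : ℕ)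
  have h1 : S.n - 1 ≤ (S.j₀ : ℕ) := h
  have h2 := S.j₀.isLt
  omega

/-- `S.LνR P lev j = P.LνRR lev j`. [folklore] -/
theorem LνR_eq_LνRR (P : ArchG3Rec S.n) (lev : ℕ) (j : Fin S.n) : S.LνR P lev j = P.LνRR lev j := S.LνR_eq P lev j

namespace SatData

variable (F : S.SatData)

/-- `Lb (sθR) lev k ≤ LbR lev k`. [folklore] -/
theorem Lb_le_LbR (htri : ∀ k j : Fin S.n, k < j → F.U k j = 0) (hbox : ∀ k j : Fin S.n, 0 ≤ F.U k j ∧ F.U k j ≤ (F.N : ℤ))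
    (hCb : ∀ j k : Fin S.n, |F.C j k| ≤ ((S.n - 1)! : ℤ) * F.N) (P : ArchG3Rec S.n) (lev : ℕ) (k : Fin S.n) :
    S.Lb (S.sθR F P) lev k ≤ P.LbR lev k := by
  unfold ArchG3Rec.LbR ArchG3Rec.sRR
  exact S.Lb_le_of_le (fun j => F.sθR_le htri hbox hCb P j) lev k

/-- `Lb (sθR) lev j₀ ≤ 2·((2Bv j₀+1)·C_{j₀j₀}/N + 2)` (`j₀` last). [folklore] -/
theorem Lb_last_le (htri : ∀ k j : Fin S.n, k < j → F.U k j = 0) (hbox : ∀ k j : Fin S.n, 0 ≤ F.U k j ∧ F.U k j ≤ (F.N : ℤ))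
    (hlast : ∀ j, j ≤ S.j₀) (P : ArchG3Rec S.n) (lev : ℕ) :
    (S.Lb (S.sθR F P) lev S.j₀ : ℝ) ≤ 2 * ((2 * P.Bv S.j₀ + 1 : ℝ) * (F.C S.j₀ S.j₀) / F.N + 2) := by
  have h1 : S.Lb (S.sθR F P) lev S.j₀ ≤ 2 * S.sθR F P S.j₀ := by
    rw [S.Lb_eq]; exact Nat.div_le_self _ _
  have h2 : (S.Lb (S.sθR F P) lev S.j₀ : ℝ) ≤ 2 * (S.sθR F P S.j₀ : ℝ) := by exact_mod_cast h1
  linarith [F.sθR_last_le htri hbox hlast P]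

/-! ### The two directional atoms -/

/-- **The jets scalar: `Σₖ AθR k · GammaC (Lb lev) k ≤ yR lev`.** [cite: Nesterenko2003, §4.2 (4.22), Lemma 4.3; shape only] -/
theorem gammaC_sum_le_yR (htri : ∀ k j : Fin S.n, k < j → F.U k j = 0) (hbox : ∀ k j : Fin S.n, 0 ≤ F.U k j ∧ F.U k j ≤ (F.N : ℤ))
    (hCb : ∀ j k : Fin S.n, |F.C j k| ≤ ((S.n - 1)! : ℤ) * F.N) (hlast : ∀ j, j ≤ S.j₀) (P : ArchG3Rec S.n) (hPN : P.N = F.N)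
    (hbB : ∀ j, |(F.bo j : ℝ)| * P.A j ≤ P.Bexp * P.A S.j₀) (hbo1 : 1 ≤ |F.bo S.j₀|) (lev : ℕ) :
    ∑ k, P.AθR k * S.GammaC (S.Lb (S.sθR F P) lev) k ≤ P.yR lev := by
  classical
  obtain ⟨hCtri, hUCd, hCpos⟩ := F.shape htri hbox
  have hjl : P.jl = S.j₀ := jl_eq P hlast
  have hN : (0 : ℝ) < F.N := F.N_pos'
  have hA0 : ∀ j, 0 < P.A j := fun j => (P.A_facts j).1
  have hAθ0 : ∀ k, 0 ≤ P.AθR k := fun k => Finset.sum_nonneg fun j _ => (hA0 j).le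
  unfold ArchG3Rec.yR
  refine Finset.sum_le_sum fun k _ => mul_le_mul_of_nonneg_left ?_ (hAθ0 k)
  -- `GammaC (Lb lev) k ≤ ΓR lev k`
  unfold GammaC ArchG3Rec.ΓR
  have hL : ((S.Lb (S.sθR F P) lev k : ℕ) : ℝ) ≤ (P.LbR lev k : ℝ) := by exact_mod_cast F.Lb_le_LbR htri hbox hCb P lev k
  have hbt : |(S.b k : ℝ)| ≤ P.btR k := by
    have h := F.abs_b_le htri hbox hCb hA0 hbB k
    unfold ArchG3Rec.btR ArchG3Rec.Alast; rw [hjl, hPN]; linarith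
  have hCll : (1 : ℝ) ≤ (F.C S.j₀ S.j₀ : ℝ) := by exact_mod_cast hCpos S.j₀
  have hCllN : (F.C S.j₀ S.j₀ : ℝ) ≤ F.N := by exact_mod_cast F.C_diag_le htri hbox S.j₀
  have hbj : (F.C S.j₀ S.j₀ : ℝ) ≤ |(S.b S.j₀ : ℝ)| := by
    rw [F.b_last_eq htri hbox hlast]; push_cast; rw [abs_mul, abs_of_pos (a := (F.C S.j₀ S.j₀ : ℝ)) (by linarith)]
    have : (1 : ℝ) ≤ |(F.bo S.j₀ : ℝ)| := by exact_mod_cast hbo1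
    nlinarith
  have hbjpos : 0 < |(S.b S.j₀ : ℝ)| := by linarith
  have hLj := F.Lb_last_le htri hbox hlast P lev
  -- the ratio term
  have hratio : |(S.b k : ℝ) / (S.b S.j₀ : ℝ)| * (S.Lb (S.sθR F P) lev S.j₀ : ℝ) ≤
      2 * P.btR k * ((2 * P.Bv P.jl + 1 : ℝ) / P.N + 2) := by
    rw [abs_div, hjl, hPN]
    have hbt0 : 0 ≤ P.btR k := (abs_nonneg _).trans hbt
    calc |(S.b k : ℝ)| / |(S.b S.j₀ : ℝ)| * (S.Lb (S.sθR F P) lev S.j₀ : ℝ)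
        ≤ (P.btR k / (F.C S.j₀ S.j₀ : ℝ)) * (2 * ((2 * P.Bv S.j₀ + 1 : ℝ) * (F.C S.j₀ S.j₀) / F.N + 2)) := by
          refine mul_le_mul ?_ hLj (by positivity) (by positivity)
          exact div_le_div₀ hbt0 hbt (by linarith) hbj
      _ = 2 * P.btR k * ((2 * P.Bv S.j₀ + 1 : ℝ) / F.N + 2 / (F.C S.j₀ S.j₀ : ℝ)) := by
          field_simp
      _ ≤ 2 * P.btR k * ((2 * P.Bv S.j₀ + 1 : ℝ) / F.N + 2) := by
          refine mul_le_mul_of_nonneg_left ?_ (by positivity)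
          have : 2 / (F.C S.j₀ S.j₀ : ℝ) ≤ 2 := by rw [div_le_iff₀ (by linarith)]; nlinarith
          linarith
  linarith

/-- **The Δ-weight ceiling: `YC 1 0 (Lb lev) ≤ YR lev`.** [cite: Nesterenko2003, §3.5 (3.36); shape only] -/
theorem YC_le_YR (htri : ∀ k j : Fin S.n, k < j → F.U k j = 0) (hbox : ∀ k j : Fin S.n, 0 ≤ F.U k j ∧ F.U k j ≤ (F.N : ℤ))
    (hCb : ∀ j k : Fin S.n, |F.C j k| ≤ ((S.n - 1)! : ℤ) * F.N) (hlast : ∀ j, j ≤ S.j₀) (P : ArchG3Rec S.n) (hPN : P.N = F.N)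
    (hbB : ∀ j, |(F.bo j : ℝ)| * P.A j ≤ P.Bexp * P.A S.j₀) (lev : ℕ) :
    S.YC 1 0 (S.Lb (S.sθR F P) lev) ≤ P.YR lev := by
  classical
  obtain ⟨hCtri, hUCd, hCpos⟩ := F.shape htri hbox
  have hjl : P.jl = S.j₀ := jl_eq P hlast
  have hN : (0 : ℝ) < F.N := F.N_pos'
  have hA0 : ∀ j, 0 < P.A j := fun j => (P.A_facts j).1
  have hCll0 : (0 : ℝ) < (F.C S.j₀ S.j₀ : ℝ) := by exact_mod_cast hCpos S.j₀
  have hCllN : (F.C S.j₀ S.j₀ : ℝ) ≤ F.N := by exact_mod_cast F.C_diag_le htri hbox S.j₀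
  have hBexp0 : 0 ≤ P.Bexp := (Real.exp_pos _).le
  -- `|b̃_{j₀}| ≤ B·N`
  have hbj : |(S.b S.j₀ : ℝ)| ≤ P.Bexp * F.N := by
    rw [F.b_last_eq htri hbox hlast]; push_cast; rw [abs_mul, abs_of_pos hCll0]
    have h1 : |(F.bo S.j₀ : ℝ)| ≤ P.Bexp := le_of_mul_le_mul_right (by linarith [hbB S.j₀]) (hA0 S.j₀)
    exact mul_le_mul h1 hCllN hCll0.le hBexp0
  have hLj := F.Lb_last_le htri hbox hlast P lev
  unfold YC ArchG3Rec.YR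
  refine Finset.sum_le_sum fun k _ => ?_
  have hL : ((S.Lb (S.sθR F P) lev k : ℕ) : ℝ) ≤ (P.LbR lev k : ℝ) := by exact_mod_cast F.Lb_le_LbR htri hbox hCb P lev k
  have hbt : |(S.b k : ℝ)| ≤ P.btR k := by
    have h := F.abs_b_le htri hbox hCb hA0 hbB k
    unfold ArchG3Rec.btR ArchG3Rec.Alast; rw [hjl, hPN]; linarith
  have hbt0 : 0 ≤ P.btR k := (abs_nonneg _).trans hbt
  simp only [Int.cast_one, abs_one, one_mul, Pi.zero_apply, Int.cast_zero, abs_zero, add_zero]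
  rw [hjl, hPN]
  have h1 : |(S.b S.j₀ : ℝ)| * (S.Lb (S.sθR F P) lev k : ℝ) ≤ P.Bexp * F.N * (P.LbR lev k : ℝ) :=
    mul_le_mul hbj hL (by positivity) (by positivity)
  have h2 : |(S.b k : ℝ)| * (S.Lb (S.sθR F P) lev S.j₀ : ℝ) ≤ 2 * P.btR k * (2 * P.Bv S.j₀ + 3 : ℝ) := by
    calc |(S.b k : ℝ)| * (S.Lb (S.sθR F P) lev S.j₀ : ℝ) ≤ P.btR k * (2 * ((2 * P.Bv S.j₀ + 1 : ℝ) * (F.C S.j₀ S.j₀) / F.N + 2)) :=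
          mul_le_mul hbt hLj (by positivity) hbt0
      _ ≤ P.btR k * (2 * ((2 * P.Bv S.j₀ + 1 : ℝ) * 1 + 2)) := by
          refine mul_le_mul_of_nonneg_left (mul_le_mul_of_nonneg_left ?_ (by norm_num)) hbt0
          have : (F.C S.j₀ S.j₀ : ℝ) / F.N ≤ 1 := by rw [div_le_one hN]; exact hCllN
          have h0 : (0 : ℝ) ≤ 2 * P.Bv S.j₀ + 1 := by positivity
          have := mul_le_mul_of_nonneg_left this h0
          rw [mul_div_assoc]; linarith
      _ = 2 * P.btR k * (2 * P.Bv S.j₀ + 3 : ℝ) := by ring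
  linarith

/-! ### The global ceilings -/

/-- `#unkA ≤ exp cUR` from the START's count. [cite: Nesterenko2003, §3.5 (3.22)–(3.23); shape only] -/
theorem card_le_exp_cUR (P : ArchG3Rec S.n) {U : Finset (ℕ × (Fin S.n → ℤ))}
    (hcount : U.card ≤ (P.L₀ + 1) * ∏ j, (S.LνR P 0 j + 1)) : (U.card : ℝ) ≤ Real.exp P.cUR := by
  unfold ArchG3Rec.cUR
  rw [Real.exp_add, Real.exp_sum, Real.exp_log (by positivity)]
  have h : (U.card : ℝ) ≤ (((P.L₀ + 1) * ∏ j, (S.LνR P 0 j + 1) : ℕ) : ℝ) := by exact_mod_cast hcount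
  refine h.trans (le_of_eq ?_)
  push_cast
  congr 1
  refine Finset.prod_congr rfl fun j _ => ?_
  rw [S.LνR_zero, Real.exp_log (by positivity)]; push_cast; ring

/-- `T·(1 + log(1 + Y/T))` is monotone in `Y ≥ 0`. [folklore] -/
theorem dir_mono {Y Y' : ℝ} (T : ℕ) (hY : 0 ≤ Y) (hYY : Y ≤ Y') :
    (T : ℝ) * (1 + Real.log (1 + Y / T)) ≤ (T : ℝ) * (1 + Real.log (1 + Y' / T)) := by
  rcases Nat.eq_zero_or_pos T with hT | hT
  · subst hT; simp
  have hT' : (0 : ℝ) < T := by exact_mod_cast hT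
  refine mul_le_mul_of_nonneg_left ?_ hT'.le
  have h1 : 0 < 1 + Y / T := by positivity
  have := Real.log_le_log h1 (by gcongr : 1 + Y / T ≤ 1 + Y' / T)
  linarith

/-- `log DΔC Y T′ ≤ log DΔC Y′ T′` for `0 ≤ Y ≤ Y′`. [folklore] -/
theorem log_DΔC_mono {Y Y' : ℝ} (T' : ℕ) (hY : 0 ≤ Y) (hYY : Y ≤ Y') : Real.log (DΔC Y T') ≤ Real.log (DΔC Y' T') := by
  rw [log_DΔC hY, log_DΔC (hY.trans hYY)]; exact dir_mono T' hY hYY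

/-- **`⌈#unkA·AmaxR⌉ ≤ exp cPR`** (lp-1's `log_AmaxR_le` at `(c, e) = (1, 0)`, `V = A`, with `YC 1 0 (Lb 0) ≤ YR 0`).
[cite: Nesterenko2003, §3.5 (3.37), Prop. 3.9; shape only] -/
theorem ceil_le_exp_cPR (htri : ∀ k j : Fin S.n, k < j → F.U k j = 0) (hbox : ∀ k j : Fin S.n, 0 ≤ F.U k j ∧ F.U k j ≤ (F.N : ℤ))
    (hCb : ∀ j k : Fin S.n, |F.C j k| ≤ ((S.n - 1)! : ℤ) * F.N) (hlast : ∀ j, j ≤ S.j₀) (P : ArchG3Rec S.n) (hPN : P.N = F.N)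
    (hbB : ∀ j, |(F.bo j : ℝ)| * P.A j ≤ P.Bexp * P.A S.j₀) (hV : ∀ j, Height.logHeight₁ (F.αo j) ≤ P.A j)
    {U : Finset (ℕ × (Fin S.n → ℤ))} (hcount : U.card ≤ (P.L₀ + 1) * ∏ j, (S.LνR P 0 j + 1)) (hU1 : 1 ≤ U.card) :
    ((⌈(U.card : ℝ) * S.AmaxR F P 1 0⌉ : ℤ) : ℝ) ≤ Real.exp P.cPR := by
  have hA1 : 1 ≤ S.AmaxR F P 1 0 := le_max_left _ _
  have hU1' : (1 : ℝ) ≤ U.card := by exact_mod_cast hU1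
  have hx1 : 1 ≤ (U.card : ℝ) * S.AmaxR F P 1 0 := one_le_mul_of_one_le_of_one_le hU1' hA1
  have hx0 : 0 < (U.card : ℝ) * S.AmaxR F P 1 0 := by linarith
  have hceil : ((⌈(U.card : ℝ) * S.AmaxR F P 1 0⌉ : ℤ) : ℝ) ≤ 2 * ((U.card : ℝ) * S.AmaxR F P 1 0) := by
    have := Int.ceil_lt_add_one ((U.card : ℝ) * S.AmaxR F P 1 0); linarith
  refine hceil.trans ?_
  unfold ArchG3Rec.cPR
  rw [Real.exp_add, Real.exp_add, Real.exp_log (by norm_num), mul_assoc]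
  refine mul_le_mul_of_nonneg_left (mul_le_mul (card_le_exp_cUR P hcount) ?_ (by linarith) (Real.exp_pos _).le) (by norm_num)
  -- `AmaxR ≤ exp logAmaxRR`
  rw [← Real.exp_log (by linarith : 0 < S.AmaxR F P 1 0)]
  refine Real.exp_le_exp.mpr ((S.log_AmaxR_le F P 1 0 hV).trans ?_)
  unfold ArchG3Rec.logAmaxRR
  have hYC : S.YC 1 0 (fun j => 2 * S.sθR F P j) ≤ P.YR 0 := by
    have h := F.YC_le_YR htri hbox hCb hlast P hPN hbB 0
    have he : (fun j => 2 * S.sθR F P j) = S.Lb (S.sθR F P) 0 := by funext j; rfl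
    rw [he]; exact h
  have hdir := dir_mono (P.Tf 0 0) (S.YC_nonneg 1 0 _) hYC
  have hsum : ∑ j, ((S.LνR P 0 j : ℝ) / F.N) * P.A j = ∑ j, ((P.LνRR 0 j : ℝ) / P.N) * P.A j := by
    refine Finset.sum_congr rfl fun j _ => ?_; rw [LνR_eq_LνRR, hPN]
  rw [hsum] at *
  linarith [hdir]

/-- `log ∏ H(θⱼ) ≤ cHR = n·Σ Aⱼ`. [cite: Nesterenko2003, §4.3 (4.45); shape only] -/
theorem log_heightProd_le_cHR (hbox : ∀ k j : Fin S.n, 0 ≤ F.U k j ∧ F.U k j ≤ (F.N : ℤ)) (P : ArchG3Rec S.n)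
    (hV : ∀ j, Height.logHeight₁ (F.αo j) ≤ P.A j) : Real.log (heightProd S.α) ≤ P.cHR := by
  refine (F.log_heightProd_le_of_sat hV).trans ?_
  unfold ArchG3Rec.cHR ArchG3Rec.SAR
  have hN : (0 : ℝ) < F.N := F.N_pos'
  rw [Finset.sum_comm, Finset.mul_sum]
  refine Finset.sum_le_sum fun j _ => ?_
  rw [← Finset.sum_mul, ← Finset.sum_div]
  have hcol : (∑ i, |(F.U i j : ℝ)|) / F.N ≤ S.n := by
    rw [div_le_iff₀ hN]
    have h := F.colsum_le hbox j
    have : (∑ i, |(F.U i j : ℝ)|) = ((∑ i, |F.U i j| : ℤ) : ℝ) := by push_cast; rfl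
    rw [this]; exact_mod_cast h
  exact mul_le_mul_of_nonneg_right hcol (P.A_facts j).1.le

/-- `Σⱼ (colU j/N)·Aⱼ ≤ n·Σ Aⱼ`. [folklore] -/
theorem colU_sum_le (hbox : ∀ k j : Fin S.n, 0 ≤ F.U k j ∧ F.U k j ≤ (F.N : ℤ)) (P : ArchG3Rec S.n) :
    ∑ j, ((F.colU j : ℝ) / F.N) * P.A j ≤ S.n * P.SAR := by
  unfold ArchG3Rec.SAR; rw [Finset.mul_sum]
  exact Finset.sum_le_sum fun j _ => mul_le_mul_of_nonneg_right (F.colU_div_le hbox j) (P.A_facts j).1.le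

/-! ### Bookkeeping for the assembly -/

/-- `yR/CR ≤ T lev` (`CR = max 1 (yR/T)`). [folklore] -/
theorem yR_div_CR_le (P : ArchG3Rec S.n) (lev : ℕ) : P.yR lev / P.CR lev ≤ P.T lev := by
  have hT : (1 : ℝ) ≤ P.T lev := by exact_mod_cast (P.T_facts lev).1
  unfold ArchG3Rec.CR
  rcases le_or_gt (P.yR lev / P.T lev) 1 with h | h
  · rw [max_eq_left h, div_one]; rwa [div_le_iff₀ (by linarith), one_mul] at h
  · rw [max_eq_right h.le]
    have hT0 : (0 : ℝ) < P.T lev := by linarith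
    have hy0 : 0 < P.yR lev := by have := (one_lt_div hT0).mp h; linarith
    rw [show P.yR lev / (P.yR lev / P.T lev) = P.T lev by field_simp]

/-- `2·(L·δ₀·m) ≤ exp (cbR c lev m)` when `L ≤ LbR lev jl`. [folklore] -/
theorem two_mul_le_exp_cbR (P : ArchG3Rec S.n) (c : ℝ) (lev m : ℕ) {L : ℝ} (hL : L ≤ P.LbR lev P.jl) :
    2 * (L * P.δR c * m) ≤ Real.exp (P.cbR c lev m) := by
  unfold ArchG3Rec.cbR ArchG3Rec.δR
  rw [Real.exp_sub, Real.exp_add, Real.exp_add, Real.exp_log (by norm_num), Real.exp_log (by positivity), Real.exp_log (by positivity),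
    div_eq_mul_inv, ← Real.exp_neg]
  have h1 : L ≤ (P.LbR lev P.jl : ℝ) + 1 := by linarith
  have h2 : (m : ℝ) ≤ m + 1 := by linarith
  have h3 : 0 ≤ Real.exp (-P.U0 c) := (Real.exp_pos _).le
  calc 2 * (L * Real.exp (-P.U0 c) * m) = 2 * L * m * Real.exp (-P.U0 c) := by ring
    _ ≤ 2 * ((P.LbR lev P.jl : ℝ) + 1) * (m + 1) * Real.exp (-P.U0 c) := by gcongr
    _ = 2 * ((P.LbR lev P.jl : ℝ) + 1) * ((m : ℝ) + 1) * Real.exp (-P.U0 c) := by ring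

end SatData

end ArchG3Setup

end Summit.ABC.StewartYu

end
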